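import Mathlib
import Summits.NavierStokesRegularity.FluidComputer.TransportGalerkinResidence
import Literature.Analysis.FunctionSpaces.TorusSobolevNormHolderProofs
import HarnessLib

/-!
# Galerkin limit of the transport model, X: ONE polynomial box for all Galerkin levels (instab g19, cell `ns-blowup`, 2026-08-27)

HONEST FRAMING (human ruling D-0035): nothing here is a claim about Navier–Stokes blow-up.
WHAT THIS IS NOT: not NS evidence — bookkeeping on the scaled phase space `E = lp (ℤ^d → V) 2`
of the R-β chain; the Galerkin trajectories and their common `H²` bound are hypotheses.

PURPOSE. The RESIDENCE hypothesis (β3) of the R-β KEEP/KILL chain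
(`TransportGalerkinAbcShift.half_prediction_abc_shift`, fields `sol_mem` + the radii `ρ` with
`∑⟨l⟩ρ_l < ∞`, `∑(⟨k⟩²ρ_k)² < ∞`) asks that ALL Galerkin levels from the seed stay in ONE compact
polynomial box `W = box ρ π P` on the window. `HOME/instab/BETA2-SPEC.md` §6 priced this as
computer-assisted integration. Here (`exists_residence_box`): for `ν > 0`, any family of Galerkin
trajectories (levels `N i`, continuous on `[0, T]`, right-differentiable on `[0, T)` with
`y' = P_N F(y)`, `P_N`-fixed, satisfying the linear box clauses) that share an `E`-norm (`H²`) bound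
`r` on the window and bounds `E₃`, `E_σ` on two initial energies (automatic for the seeds
`P_N(ε v)`: truncation does not increase any energy) lies in one box `ρ k = (√R + C₀) ⟨k⟩^{−(d+3)}`
with summable radii and a prescribed polynomial floor `C₀ ⟨k⟩^{−(d+3)} ≤ ρ k` (the floor makes the
seed clause `ε•v ∈ W` satisfiable, `TransportGalerkinEigen.exists_smul_mem_box_of_rapidDecay`).
The `H²` bound is exactly what the bootstrap supplies (`‖u_n t‖ ≤ (3/2)εe^{λt}`); so residence is
reduced to it plus the global existence of the finite-dimensional Galerkin ODE — no engine.

Ingredients: `TransportGalerkinResidence.energy_three_le` (absorption at order three),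
`energy_le_of_energy_three_le` (order `d + 5`), `TransportGalerkinResidencePrep.norm_apply_le_of_eNormSq_le`,
and the lattice `p`-series `Torus.summable_sobolevWeight_neg_sq`.
-/

noncomputable section

open scoped ENNReal NNReal ComplexConjugate InnerProductSpace
open Set Filter Topology

namespace Summit.NavierStokesRegularity.FluidComputer.TransportGalerkinResidenceBox

open RCLike
open Literature.Analysis.FunctionSpaces Literature.Analysis.FunctionSpaces.Lattice
open Literature.Analysis.FunctionSpaces.Torus
open Literature.Analysis.ODE
open Summit.NavierStokesRegularity.FluidComputer.GalerkinLatticePhaseSpace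
open Summit.NavierStokesRegularity.FluidComputer.TransportGalerkin
open Summit.NavierStokesRegularity.FluidComputer.TransportGalerkinRapid
open Summit.NavierStokesRegularity.FluidComputer.TransportGalerkinBox
open Summit.NavierStokesRegularity.FluidComputer.TransportGalerkinResidencePrep
open Summit.NavierStokesRegularity.FluidComputer.TransportGalerkinResidence

variable {d : Type*} [Fintype d] [DecidableEq d]
variable {V : Type*} [NormedAddCommGroup V] [InnerProductSpace ℂ V] [CompleteSpace V]

/-! ## §1 Summable polynomial radii -/

section Radii

omit [DecidableEq d] in
/-- `⟨k⟩ · ⟨k⟩^{−(d+3)} = (⟨k⟩^{−(d+2)/2})²`. -/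
theorem sobolevWeight_one_mul_neg (k : d → ℤ) :
    sobolevWeight 1 k * sobolevWeight (-((Fintype.card d : ℝ) + 3)) k =
      sobolevWeight (-(((Fintype.card d : ℝ) + 2) / 2)) k ^ 2 := by
  rw [sq, ← sobolevWeight_add, ← sobolevWeight_add]; ring_nf

omit [DecidableEq d] in
/-- `(⟨k⟩² · ⟨k⟩^{−(d+3)})² = (⟨k⟩^{−(d+1)})²`. -/
theorem sobolevWeight_two_mul_neg_sq (k : d → ℤ) :
    (sobolevWeight 2 k * sobolevWeight (-((Fintype.card d : ℝ) + 3)) k) ^ 2 =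
      sobolevWeight (-((Fintype.card d : ℝ) + 1)) k ^ 2 := by
  rw [← sobolevWeight_add]; ring_nf

omit [DecidableEq d] in
/-- **The radii `ρ k = C ⟨k⟩^{−(d+3)}` satisfy both summability hypotheses of the R-β chain**:
`∑_k ⟨k⟩ρ_k < ∞` and `∑_k (⟨k⟩²ρ_k)² < ∞` (lattice `p`-series `Torus.summable_sobolevWeight_neg_sq`). -/
theorem summable_radii (C : ℝ) :
    (Summable fun k : d → ℤ => sobolevWeight 1 k * (C * sobolevWeight (-((Fintype.card d : ℝ) + 3)) k))
    ∧ Summable fun k : d → ℤ => (sobolevWeight 2 k * (C * sobolevWeight (-((Fintype.card d : ℝ) + 3)) k)) ^ 2 := by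
  constructor
  · have h := (summable_sobolevWeight_neg_sq (d := d) (t := ((Fintype.card d : ℝ) + 2) / 2)
      (by linarith)).mul_left C
    refine h.congr fun k => ?_
    rw [← sobolevWeight_one_mul_neg]; ring
  · have h := (summable_sobolevWeight_neg_sq (d := d) (t := (Fintype.card d : ℝ) + 1)
      (by linarith [Nat.cast_nonneg (α := ℝ) (Fintype.card d)])).mul_left (C ^ 2)
    refine h.congr fun k => ?_
    rw [← sobolevWeight_two_mul_neg_sq]; ring

end Radii

/-! ## §2 One box for all levels -/

section Box

variable {ν : ℝ} {Uv : (d → ℤ) → V} {π : d → (V →L[ℂ] ℂ)} {P : (d → ℤ) → (V →L[ℂ] V)}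
  {ρ₀ : (d → ℤ) → ℝ}

/-- **RESIDENCE from the bootstrap's `H²` bound (`exists_residence_box`).** Host: `ν > 0`, `Uv`
rapidly decreasing, real and divergence-free through `π` (`‖π_j‖ ≤ 1`), `P` modewise self-adjoint
contractions, `σ₂² = ∑⟨l⟩⁻⁴ < ∞` (true for `card d ≤ 3`). Trajectories: a family `y i` (any index
type; levels `N i`) on `[0, T]`, each continuous, right-differentiable on `[0, T)` with
`(y i)' = P_{N i} F(y i)`, `P_{N i}`-fixed and in `box ρ₀ π P` (only the three linear clauses are
used), with a COMMON bound `‖y i t‖ ≤ r` and common bounds `E₃`, `E_σ` (`σ = card d + 5`) on the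
initial energies `‖Λ⁻² ⇑(y i 0)‖₃²`, `‖Λ⁻² ⇑(y i 0)‖_σ²`. Then there are radii
`ρ k = (√R + C₀)⟨k⟩^{−(d+3)}` (any prescribed `C₀ ≥ 0`), nonnegative, with `∑⟨k⟩ρ_k < ∞` and
`∑(⟨k⟩²ρ_k)² < ∞` (the radii hypotheses of `half_prediction_nsField_shift` / `half_prediction_abc_shift`),
the floor `C₀⟨k⟩^{−(d+3)} ≤ ρ k`, and `y i t ∈ box ρ π P` for every `i` and `t ∈ [0, T]`. -/
theorem exists_residence_box (hν : 0 < ν) (hUv : RapidDecay Uv) (hπ : ∀ j, ‖π j‖ ≤ 1)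
    (hUreal : ∀ j p, π j (Uv (-p)) = conj (π j (Uv p)))
    (hUdiv : ∑ j, freqDeriv j (fun p => π j (Uv p)) = 0)
    (hPsa : ∀ k, IsSelfAdjoint (P k)) (hP : ∀ k, ‖P k‖ ≤ 1)
    (hσ₂ : ∑' l : d → ℤ, ENNReal.ofReal (sobolevWeight (-2) l ^ 2) < ∞)
    {ι : Type*} {N : ι → ℕ} {y : ι → ℝ → lp (fun _ : (d → ℤ) => V) 2} {T r E₃ Eσ C₀ : ℝ}
    (hr : 0 < r) (hE₃ : 0 ≤ E₃) (hEσ : 0 ≤ Eσ) (hC₀ : 0 ≤ C₀)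
    (hcont : ∀ i, ContinuousOn (y i) (Icc 0 T))
    (hderiv : ∀ i, ∀ t ∈ Ico 0 T,
      HasDerivWithinAt (y i) (cubeProj (N i) (nsField ν Uv π P (y i t))) (Ici t) t)
    (hproj : ∀ i, ∀ t ∈ Icc 0 T, cubeProj (N i) (y i t) = y i t)
    (hW : ∀ i, ∀ t ∈ Icc 0 T, y i t ∈ box ρ₀ π P)
    (hbd : ∀ i, ∀ t ∈ Icc 0 T, ‖y i t‖ ≤ r)
    (h3 : ∀ i, (eNormSq 3 (wmul (-2) ⇑(y i 0))).toReal ≤ E₃)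
    (hσ0 : ∀ i, (eNormSq ((Fintype.card d + 5 : ℕ) : ℝ) (wmul (-2) ⇑(y i 0))).toReal ≤ Eσ) :
    ∃ ρ : (d → ℤ) → ℝ, (∀ k, 0 ≤ ρ k)
      ∧ (Summable fun k => sobolevWeight 1 k * ρ k)
      ∧ (Summable fun k => (sobolevWeight 2 k * ρ k) ^ 2)
      ∧ (∀ k, C₀ * sobolevWeight (-((Fintype.card d : ℝ) + 3)) k ≤ ρ k)
      ∧ ∀ i, ∀ t ∈ Icc 0 T, y i t ∈ box ρ π P := by
  set σ : ℕ := Fintype.card d + 5 with hσdef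
  have hσ1 : 1 ≤ σ := by omega
  -- the order-three constants (as in `energy_three_le`)
  set α₃ : ℝ := 2 * ν * (2 * Real.pi) ^ 2
      + 2 * ((3 * (2 : ℝ) ^ 3) * (2 * Real.pi) *
          (∑ j, (symbNorm (3 : ℝ) (scal (fun p => π j (Uv p)) : (d → ℤ) → (V →L[ℂ] V))).toReal)
        + (2 : ℝ) ^ ((3 : ℝ) / 2) * ((Fintype.card d : ℝ) * (2 * Real.pi)) *
          (∑' l, ENNReal.ofReal (sobolevWeight 4 l) * ‖Uv l‖ₑ).toReal) with hα₃
  set β₃ : ℝ := 27 * (2 * ((Fintype.card d : ℝ) * (3 * (2 : ℝ) ^ 3) * (2 * Real.pi)) *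
          Real.sqrt (∑' l : d → ℤ, ENNReal.ofReal (sobolevWeight (-2) l ^ 2)).toReal) ^ 4 /
      (256 * (2 * ν * (2 * Real.pi) ^ 2 / r ^ 2) ^ 3) with hβ₃
  have hα₃0 : 0 ≤ α₃ := by positivity
  have hβ₃0 : 0 ≤ β₃ := by positivity
  set R₃ : ℝ := (E₃ + β₃ * |T|) * Real.exp (α₃ * |T|) with hR₃
  have hR₃0 : 0 ≤ R₃ := by positivity
  -- order three on the window
  have hS3 : ∀ i, ∀ t ∈ Icc 0 T, (eNormSq 3 (wmul (-2) ⇑(y i t))).toReal ≤ R₃ := by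
    intro i t ht
    have hT : T = |T| := (abs_of_nonneg (ht.1.trans ht.2)).symm
    have h := energy_three_le hν hUv hπ hUreal hUdiv hPsa hP hσ₂ hr (hcont i) (hderiv i) (hproj i)
      (hW i) (hbd i) t ht
    refine h.trans ((gronwallBound_le_window ENNReal.toReal_nonneg hα₃0 hβ₃0 ht.1
      (ht.2.trans_eq hT)).trans ?_)
    rw [hR₃]
    exact mul_le_mul_of_nonneg_right (add_le_add_left (h3 i) _) (Real.exp_pos _).le
  -- order σ on the window
  set ασ : ℝ := 2 * ν * (2 * Real.pi) ^ 2
      + 2 * ((σ * (2 : ℝ) ^ σ) * (2 * Real.pi) *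
          (∑ j, (symbNorm (σ : ℝ) (scal (fun p => π j (Uv p)) : (d → ℤ) → (V →L[ℂ] V))).toReal)
        + (2 : ℝ) ^ ((σ : ℝ) / 2) * ((Fintype.card d : ℝ) * (2 * Real.pi)) *
          (∑' l, ENNReal.ofReal (sobolevWeight ((σ : ℝ) + 1) l) * ‖Uv l‖ₑ).toReal)
      + 2 * ((Fintype.card d : ℝ) * (σ * (2 : ℝ) ^ σ) * (2 * Real.pi)) *
          Real.sqrt (∑' l : d → ℤ, ENNReal.ofReal (sobolevWeight (-2) l ^ 2)).toReal *
          Real.sqrt R₃ with hασ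
  have hασ0 : 0 ≤ ασ := by positivity
  set R : ℝ := Eσ * Real.exp (ασ * |T|) with hR
  have hR0 : 0 ≤ R := by positivity
  have hSσ : ∀ i, ∀ t ∈ Icc 0 T, (eNormSq (σ : ℝ) (wmul (-2) ⇑(y i t))).toReal ≤ R := by
    intro i t ht
    have hT : t ≤ |T| := ht.2.trans (le_abs_self T)
    have h := energy_le_of_energy_three_le hν.le hUv hπ hUreal hUdiv hPsa hP hσ₂ hσ1 hR₃0 (hcont i)
      (hderiv i) (hproj i) (hW i) (hS3 i) t ht
    refine h.trans ?_
    rw [hR]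
    exact mul_le_mul (hσ0 i) (Real.exp_le_exp.2 (mul_le_mul_of_nonneg_left hT hασ0))
      (Real.exp_pos _).le hEσ
  -- the radii
  set ρ : (d → ℤ) → ℝ := fun k => (Real.sqrt R + C₀) * sobolevWeight (-((Fintype.card d : ℝ) + 3)) k
    with hρ
  refine ⟨ρ, fun k => mul_nonneg (add_nonneg (Real.sqrt_nonneg _) hC₀) (sobolevWeight_pos _ _).le,
    (summable_radii (d := d) (Real.sqrt R + C₀)).1,
    (summable_radii (d := d) (Real.sqrt R + C₀)).2, fun k => ?_, fun i t ht => ?_⟩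
  · rw [hρ]
    exact mul_le_mul_of_nonneg_right (le_add_of_nonneg_left (Real.sqrt_nonneg _))
      (sobolevWeight_pos _ _).le
  · -- coordinates from the order-σ energy: `‖⇑(y i t)‖_{σ-2}² = S_σ ≤ R`
    have hxr : RapidDecay (⇑(y i t)) := by rw [← hproj i t ht]; exact rapidDecay_coe_cubeProj (N i) (y i t)
    have hs : ((σ : ℝ) - 2) = (Fintype.card d : ℝ) + 3 := by rw [hσdef]; push_cast; ring
    have hfin : eNormSq ((σ : ℝ) - 2) (⇑(y i t)) < ∞ := eNormSq_lt_top_of_rapidDecay hxr _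
    have hle : (eNormSq ((σ : ℝ) - 2) (⇑(y i t))).toReal ≤ R := by
      rw [← eNormSq_unscale]; exact hSσ i t ht
    obtain ⟨_, h2, h3', h4⟩ := hW i t ht
    refine ⟨fun k => ?_, h2, h3', h4⟩
    calc ‖(y i t : (d → ℤ) → V) k‖ ≤ Real.sqrt R * sobolevWeight (-((σ : ℝ) - 2)) k :=
          norm_apply_le_of_eNormSq_le hfin hle k
      _ ≤ ρ k := by
          rw [hρ, hs]
          exact mul_le_mul_of_nonneg_right (le_add_of_nonneg_right hC₀) (sobolevWeight_pos _ _).le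

end Box


end Summit.NavierStokesRegularity.FluidComputer.TransportGalerkinResidenceBox

end
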